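import Literature.AnabelianGeometry.EtaleTheta.LogDivisorModelTateTowerKummerTwistTempered
import Literature.AnabelianGeometry.EtaleTheta.TemperedFrobenioidCnst
import HarnessLib

/-!
# [EtTh] Prop. 3.4 (ii) at the ζ-TWISTED Kummer–Tate tower: the CONSTANT constant-field functor is REFUTED — `Prop34Cnst₀` with
# `D^cnst := const` FAILS, because the constants' roots of unity MOVE along a covering (print's NON-constant `D^cnst` is needed)

S. Mochizuki, *The étale theta function …*, Publ. RIMS **45** (2009) [MochizukiEtTh2009], §3 Prop. 3.4 (ii) p.74 («the assignment
`Y^log ↦ F₀(Y^log)` … determines a functor `D₀ → D^cnst` to the category of finite étale coverings of `Spec K`»), Thm. 3.7 (iii) p.79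
[cite: MochizukiEtTh2009, Prop 3.4 (ii) p.74].

PROOF-ONLY NEGATIVE / TIGHTNESS result (theorems only; abc-iut cell, layer L2, seat abc-iut-L2-d2 gen 6; row «ζ-TWISTED KUMMER TOWER»
R677/R689/R722).  At the two previous models of record (abc-iut-w6-d048's Tate tower, the v2 Kummer–Tate tower) abc-iut-L2-t3's
predicate bundle `DivisorMonoids.Prop34Cnst₀ cnst` was discharged with the CONSTANT functor `cnst := (Functor.const _).obj X₀`
(`TateTowerKummer.prop34Cnst₀_ofTower`, p467759): there every constant `b ∈ F₀(Y′)` takes ONE value on the transitive `Grp`-set `Y′`.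
Here (`towerC`, p478618) this SHORTCUT BREAKS — which is the content the ζ-twist row was created for:
* `rho_eq_one_of_mem_vSub` — this seat's open normal subgroups `V_n` (p482079) act trivially at every level `l ≤ n` (by the
  COMPATIBILITY `c_l ≡ c_{l-1}`, `k_l ≡ k_{l-1} (mod M_{l-1} = N_l)`); `closureC_le_vSub`; the covering `Y₂ := Compat/V_2` has level
  EXACTLY `2` (`lvlC_quotV`), so its functions carry `μ_6`;
* **`not_prop34Cnst₀_const : ¬ (DivisorMonoids.ofTower towerC).Prop34Cnst₀ ((Functor.const _).obj X₀)`** for EVERY constant functor: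
  the constant `b ∈ F₀(Y₂)` with `b([g]) = χ(g)·ζ₆` (abc-iut-w6-d048's `exists_bZero_quotient_of_invariant`) and the deck transformation
  `[x] ↦ [x·conjC]` of `Y₂` (`conjC` = character `−1`, normalises `V_2`) pull `b` back to `ζ₆` resp. `ζ₆⁻¹ ≠ ζ₆` — so the pull-back
  action of `D₀` on `F₀` does NOT factor through a constant `D^cnst`.  Hence at the twisted model Thm. 3.7 (iii)'s «`Aut_C(A) → Aut(A_D)`
  factors through `D^cnst`» requires print's GENUINE (non-constant) constant-field functor `Y ↦ Spec K_Y` — booked as the successor item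
  «PROP34CNST₀ WITH NON-CONSTANT `D^cnst` AT THE TWISTED TOWER» (then gen 5's `thm37_ofRankOneObjectR_of_inputs` applies at `Λ = ℝ`).
HONEST FRAMING: a kernel fact about OUR class-(b) design model; it refutes a SHORTCUT used at earlier models, not a statement of print
(print's `D^cnst` is non-constant); nothing here bears on [IUTchIII] Cor. 3.12; no side taken; typed ≠ proved.
-/

noncomputable section

namespace Literature.AnabelianGeometry.EtaleTheta

open CategoryTheory Opposite Function Literature.AlgebraicGeometry.Frobenioids Literature.AnabelianGeometry.SemiGraphs
  Literature.AlgebraicGeometry.Frobenioids.QuasiTemperoid LogDivisorModel LogDivisorModel.GaloisAction LogDivisorModel.TateTowerTwist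
  LogDivisorTower

namespace TateTowerKummerTwist

/-! ## §1 `V_n` acts trivially at the levels `l ≤ n`; the covering `Compat/V_2` has level `2` -/

/-- **`V_n` acts trivially at every level `l ≤ n`**: the index-`l` Kummer class and character of `g ∈ V_n` vanish mod `N_l = M_{l−1}`
by COMPATIBILITY with the (trivial) index-`(l−1)` coordinates. [cite: MochizukiEtTh2009, Def 3.3 (ii) p.73] -/
theorem rho_eq_one_of_mem_vSub {n l : ℕ} (hl : l ≤ n) {g : Compat} (hg : g ∈ vSub n) : rho l (g : Grp) = 1 := by
  obtain ⟨h2, hc⟩ := hg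
  refine Prod.ext (SemidirectProduct.ext (Multiplicative.toAdd.injective ?_) (MulEquiv.ext fun ζ =>
    Multiplicative.toAdd.injective ?_)) h2
  · rw [rho_left, toAdd_kumN]
    change castN l (((g : Grp)).1.left.toAdd l).2 = 0
    rcases l with _ | m
    · haveI : Subsingleton (ZMod (N 0)) := ZMod.subsingleton_iff.2 rfl
      exact Subsingleton.elim _ _
    · rw [RingHom.congr_fun (Subsingleton.elim (castN (m + 1)) (res (Nat.le_succ m))) _]
      change (resK (Nat.le_succ m) ((g : Grp).1.left.toAdd (m + 1))).2 = 0
      rw [g.2.1 m (m + 1) (Nat.le_succ m), (hc m (Nat.lt_of_succ_le hl)).1, Prod.snd_zero]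
  · rw [rho_right, toAdd_chiN]
    suffices hc1 : castN l ((g : Grp).1.right l : ZMod (M l)) = 1 by
      rw [hc1, one_mul]; rfl
    rcases l with _ | m
    · haveI : Subsingleton (ZMod (N 0)) := ZMod.subsingleton_iff.2 rfl
      exact Subsingleton.elim _ _
    · rw [RingHom.congr_fun (Subsingleton.elim (castN (m + 1)) (res (Nat.le_succ m))) _]
      have h := congrArg Units.val (g.2.2 m (m + 1) (Nat.le_succ m))
      rw [(hc m (Nat.lt_of_succ_le hl)).2, Units.val_one] at h
      exact h

/-- `Δ_n ∩ compat ⊆ V_n`. [cite: MochizukiEtTh2009, Def 3.3 (i) p.72] -/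
theorem closureC_le_vSub (n : ℕ) : closureC n ≤ vSub n := fun g hg => by
  obtain ⟨h2, hr, hk⟩ := (mem_closure_iff n (g : Grp)).1 ((mem_closureC_iff n g).1 hg)
  exact ⟨h2, fun i hi => ⟨hk i hi, by rw [hr, Pi.one_apply]⟩⟩

/-- **The connected tempered covering `Compat/V_n` has level EXACTLY `n`** (`≥ n`: `V_n ⊆ kumLevelC n`; `≤ n`: the normal subgroup
`Δ_n ∩ compat ⊆ V_n` fixes every coset). [cite: MochizukiEtTh2009, Def 3.3 (ii) p.73] -/
theorem lvlC_quotV (n : ℕ) : lvlC (quotCoverC (vSub n) (isOpen_vSub n) (countable_quotient_vSub n)) = n := by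
  refine le_antisymm (lvlC_le fun g hg y => ?_) (le_lvlC_quotCoverC _ _ _ fun g hg i hi => (hg.2 i hi).1)
  induction y using QuotientGroup.induction_on with
  | H x =>
    refine (ofMulAction_quot_fix_iff (vSub n) x g).2 (closureC_le_vSub n ?_)
    have h := (closureC_normal n).conj_mem g hg x⁻¹
    rwa [inv_inv] at h

/-! ## §2 The refutation of the constant constant-field functor -/

/-- **At the ζ-twisted tower `Prop34Cnst₀` FAILS for every CONSTANT functor `D^cnst`**: over `Y₂ = Compat/V_2` (level `2`, functions
`μ_6 × ⟨ϖ_2⟩ × ⟨U_2⟩`) the constant `b ∈ F₀(Y₂)`, `b([g]) = χ(g)·ζ₆`, pulls back to `ζ₆` along `𝟙` and to `ζ₆⁻¹` along the deck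
transformation `[x] ↦ [x·conjC]` — two covering maps with the SAME image under a constant functor but DIFFERENT actions on `F₀`.
[cite: MochizukiEtTh2009, Prop 3.4 (ii) p.74] -/
theorem not_prop34Cnst₀_const {Dc : Type*} [Category Dc] (X₀ : Dc) :
    ¬ (DivisorMonoids.ofTower towerC).Prop34Cnst₀ ((Functor.const (ConnectedPart (BTemp Compat))).obj X₀) := by
  intro h
  let Y : ConnectedPart (BTemp Compat) := quotCoverC (vSub 2) (isOpen_vSub 2) (countable_quotient_vSub 2)
  have hl : lvlC Y = 2 := lvlC_quotV 2
  -- the root of unity `ζ₆` of the level of `Y` and the constant `b ∈ F₀(Y)` with `b([1]) = ζ₆`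
  let ζ₀ : MuN (lvlC Y) := Multiplicative.ofAdd 1
  obtain ⟨b, hb⟩ := (actC (lvlC Y)).exists_bZero_quotient_of_invariant (vSub 2) (f := zeta (MuN (lvlC Y)) ζ₀) trivial
    (fun v hv => by
      change actFnHom (rho (lvlC Y) (v : Grp)) (zeta (MuN (lvlC Y)) ζ₀) = zeta (MuN (lvlC Y)) ζ₀
      rw [rho_eq_one_of_mem_vSub hl.le hv, map_one, MulAut.one_apply])
  have e1 : ∀ x : Compat, (x : Compat ⧸ vSub 2) = (Action.ofMulAction Compat (Compat ⧸ vSub 2)).ρ x ((1 : Compat) : Compat ⧸ vSub 2) :=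
    fun x => by rw [Action.ofMulAction_apply, MulAction.Quotient.smul_coe, smul_eq_mul, mul_one]
  have hbx : ∀ x : Compat, b.1 (x : Compat ⧸ vSub 2) = actFnHom (rho (lvlC Y) (x : Grp)) (zeta (MuN (lvlC Y)) ζ₀) := fun x => by
    have h1 := b.2.2 x ((1 : Compat) : Compat ⧸ vSub 2)
    rw [hb] at h1
    exact (congrArg b.1 (e1 x)).trans h1
  have hbF : b ∈ (actC (lvlC Y)).fZero (gset Y) := fun s => by
    induction s using QuotientGroup.induction_on with
    | H x =>
      change b.1 (x : Compat ⧸ vSub 2) ∈ (model (MuN (lvlC Y))).const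
      rw [hbx, actFnHom_zeta]
      exact zeta_mem_const _ _
  -- the deck transformation `[x] ↦ [x · conjC]`
  obtain ⟨f₀, hf₀⟩ := BTempConnected.exists_hom_of_stabilizer_le (T₁ := Y.obj) (T₂ := Y.obj) ((1 : Compat) : Compat ⧸ vSub 2)
    (fun q => by
      induction q using QuotientGroup.induction_on with
      | H g => exact ⟨g, (e1 g).symm⟩)
    ((conjC : Compat) : Compat ⧸ vSub 2) (fun g hg => by
      have hg' := (ofMulAction_quot_fix_iff (vSub 2) 1 g).1 hg
      rw [inv_one, one_mul, mul_one] at hg'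
      refine (ofMulAction_quot_fix_iff (vSub 2) conjC g).2 ?_
      have hc := (vSub_normal 2).conj_mem g hg' conjC⁻¹
      rwa [inv_inv] at hc)
  let f : Y ⟶ Y := ObjectProperty.homMk f₀
  -- the constant functor does not see the difference between `𝟙` and `f` …
  have key := h.B₀_map_eq_of_cnst_map_eq (𝟙 Y) f rfl b hbF
  -- … but `b` does: evaluate both pull-backs at `[1]`
  have key1 := congrArg (fun β : (towerC.act (levelsC.lvl Y)).bZero (gset Y) => β.1 ((1 : Compat) : Compat ⧸ vSub 2)) key
  change resFnC (le_of_levelsC (levelsC.closure_lvl_mono (𝟙 Y))) (b.1 ((1 : Compat) : Compat ⧸ vSub 2)) =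
    resFnC (le_of_levelsC (levelsC.closure_lvl_mono f)) (b.1 (f₀.hom.hom ((1 : Compat) : Compat ⧸ vSub 2))) at key1
  rw [hf₀, hb, hbx, ← actC_actFn_apply, actFn_conjC_zeta] at key1
  -- `resFnC` is injective on the root-of-unity coordinate: `ζ₆ = ζ₆⁻¹`, i.e. `1 = -1 (mod 6)`
  have key2 := upAdd_injective (le_refl (lvlC Y)) (congrArg (fun z : Fn (MuN (lvlC Y)) => Multiplicative.toAdd z.1) key1)
  change Multiplicative.toAdd ζ₀ = Multiplicative.toAdd ζ₀⁻¹ at key2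
  rw [toAdd_inv] at key2
  change (1 : ZMod (N (lvlC Y))) = -1 at key2
  haveI : Fact (2 < ((N (lvlC Y) : ℕ+) : ℕ)) := ⟨by rw [hl]; decide⟩
  exact ZMod.neg_one_ne_one key2.symm

end TateTowerKummerTwist

end Literature.AnabelianGeometry.EtaleTheta

end
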